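import Summits.QuantumFields.YangMills.Theorems.BalabanUVNodesN22WindowOfLocalTerms
import Literature.MathematicalPhysics.QuantumFieldTheory.Balaban1983to89.B12Decay510Torus

/-!
# NODE N22 (NE9) — THE (α)→(β′) LEG IN KERNEL CURRENCY, SOFT-LOCALIZED ROAD: the windowed history-difference bound of def-B's scalar kernel
# of a (1.7) localized sum from PER-TERM kernel(-difference) bounds WITH EXPONENTIAL TAILS `C_E·e^{−κ d_j(X)}·e^{−δ₀ dist(x,X)}·e^{−δ₀ dist(y,X)}`
# ([I] p. 282 ∕ (4.35)–(4.37) ⇒ (5.10) p. 293), resummed over `B12Decay510`'s site geometry (generic) and ON THE TORUS OF PRINT (every geometric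
# leaf discharged), plus the EVENTUAL ISOMETRY of def-B's window `siteOfInt` — output: seat dag-n22-w3's windowed input `hK` in its own shape

Cell `pub-ymgap`, Track A (HUMAN RULING D-0062), WIDTH SEAT `dag-n22-w2` (g2) on node n22 = NE9; `--kind proof --supports stmt-QuantumFields-20544 --as helper`
(K3⁷ `SpineGivenEndpointR13SepCoPH`), COUNT-NEUTRAL; THEOREMS ONLY (0 `def`, 0 `sorry`, standard axioms).  Consumes BY NAME dag-n22-c's module J27 (`WindowOfLocalTerms`,
`supp := univ`), `B12Decay510` ∕ `B12Decay510Torus` (cell pub-balaban) and def-B's `Node00.{polScalar, polWindow, siteOfInt}`; nothing re-declared.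

WHY THIS ROAD (plan g81 Q1 RULING (β): «N22 owed in KERNEL currency; the walk (α)→(β′)→(β) = n22 lane»).  The (β′)→(β) passage is dag-n22-w3's
`AtKernels.ne9_EA_of_windowed` (p593053): windowed finite-volume joint history-Lipschitz bounds UNIFORM in the run length `K` (`hK`) + def-B's `PolLimitExists`
⇒ NE9 of the limiting (1.21) kernels.  Module J27 reduces `hK` to per-term bounds under a HARD support clause (`hterm`: the term's kernel at `(x, y)` vanishes
unless both sites are the term's) and a two-point TREE sum (`htree`); module J28 derives the hard clause from a LOCALITY law «the term reads the probe field only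
on its own sites».  At the terms OF RECORD that law is not available: [I] p. 264 «Let us denote 𝐄^{(j+1)}(g_j, B) = 𝐄^{(j+1)}(g_j, U_{j+1}(exp iB))» — the (1.7)
term `E^{(k+1)}(X; hist; ·)` is local in the background pair `(𝐔, 𝐉)|_X` ([II] (1.34), [III] (2.27)(i)), but it reads the PROBE field `B` THROUGH THE MINIMIZER
`U_{k+1}(·)` (def-W1's `ReadingMaps`: «of record: the β-layer's minimizer followed by the pair reading»), which is not local in `B`; print carries exponential tails
instead — p. 282: «if one of the functions B_i is localized outside the domain X, then we have the additional exponential factor exp(−δ₀dist^{(ξ)}(X, supp B_i))»,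
and (4.35)∕(4.37) «yields» (5.10) p. 293.  So at the record the per-term kernel (and its history DIFFERENCE, the term-level NE9 modulus replacing `E₀`) has the
SOFT shape of `B12Decay510.KernelBound`, `|Π_X(g)(x,y) − Π_X(g′)(x,y)| ≤ C_E·e^{−κ d_j(X)}·e^{−δ₀ dist(x,X)}·e^{−δ₀ dist(y,X)}` with `C_E ∝ Σ_i Λ_i|g_i − g′_i|`, and the
resummation is the (5.10) polymer sum (`B12Decay510.sum_abs_le`: regroup by the nearest cube, domain sum (0.26)∕(1.26), cube sum), NOT a hard two-point tree sum.
THIS FILE types that road into J27's own §3 (taking `supp := univ`, so that J27's per-term slot accepts the soft majorant at the fixed pair of sites) and out to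
dag-n22-w3's `hK`.

WHAT.  §1 (generic `G : B12Decay510.SiteGeometry C T`, distance `dist`): `sum_softWeight_le` (`Σ_X C_E e^{−κd}e^{−δ₀dist(x,X)}e^{−δ₀dist(y,X)} ≤ C_E e^{δ₁Mc₁}K₀K₁
e^{−δ₁dist(x,y)}` under the three leaves, `0 ≤ δ₁ ≤ δ₀∕2`, `δ₁M ≤ κ∕2`); ★ `abs_polScalar_sum_sub_le_of_softKernelBound` (history difference of def-B's scalar kernel
of `Σ_X ℰ X`); `abs_polScalar_sum_le_of_softKernelBound` (value twin, the (D4)∕(5.10) input).  §2 (THE TORUS OF PRINT: sites `(ℤ∕NM)^d`, cubes `(ℤ∕N)^d` of side `M`,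
domains `TDom d N`, `d_j = torusTreeLen`, periodic ℓ¹ length `pl1`; leaves DISCHARGED by `B12Decay510Torus`): ★ `abs_polScalar_sum_sub_le_torus`, `abs_polScalar_sum_le_torus`
(constant `C_E e^{3Mdδ₁} K₀(4·2ᵈ,2d) K₁(d,δ₀∕2)`, `δ₁ = ½min{δ₀, κ(Md)⁻¹}`; hypotheses `δ₀ > 0`, `κ∕2 ≥ κ₀(4·2ᵈ,2d)` only).  §3 (def-B's window on the `K`-th torus,
sites `Site (F.P K) j`, any site geometry there): ★ `abs_polWindow_sum_sub_le_of_softKernelBound`, `abs_polWindow_sum_le_of_softKernelBound`.  §4 (the eventual isometry of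
def-B's window, (1.21) «T^{(j+1)} ↗ Z^d» = `K → ∞` inside one family): `sitesPerDir_level_tendsto`, `siteOfInt_eq_proj` (`rfl`), ★ `pl1_siteOfInt_sub_eventually`
(`|site(z) − site(0)|_{per,1} = |z|₁` for all large `K`).  §5 (UNIFORMITY IN `K` ⇒ dag-n22-w3's `hK`): ★★ `eventually_abs_polWindow_sum_sub_le` (K-uniform soft constants
and leaves, distances dominating `|z|₁ − c₂` at the window sites eventually ⇒ `∀ᶠ K, |Δ polWindow| ≤ C·w·e^{δ₁c₂}·e^{−δ₁|z|₁}`), `…_pl1` (periodic ℓ¹, `c₂ = 0` by §4),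
`const_mul_historyModulus`, ★★ `eventually_abs_polWindow_sum_sub_le_hK` (`w := Σ_{i<k+1} Λ_{k+1,i}|g_i − g′_i|` ⇒ `≤ e^{−δ₁|z|₁}·Σ_{i<k+1} (C·Λ_{k+1,i})|g_i − g′_i|` =
`AtKernels.ne9_EA_of_windowed`'s hypothesis with moduli `C·Λ`).

LOCATED (honest).  (i) The per-term soft bounds (term-level NE9 on the (4.4) analyticity ball × the minimizer tails of [15] Sect. G ∕ p. 282, in the (4.35)
representation; `B12Decay510.kernelBound_of_repr435` is the printed route) are DISPLAYED hypotheses (`hterm`), NODE A ∕ NODE O ∕ J-road content.  (ii) §5's site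
geometries `G K` on `Site (F.P K) j` over the catalogue of record `Sect2.domSys (F.P K) M j = tsys 4 (domCount …)` with K-UNIFORM leaves are a PARAMETER in this file: the
torus model `B12Decay510Torus.geomT 4 N M` carries them (§2) on the site type `(ℤ∕NM)⁴`; the sequel `…N22WindowSoftTwoPointTorus` pulls that geometry back along the canonical
site map `ZMod.cast` INSIDE a proof (no object declared) and `…DomSys` proves the moduli identity `domCount·L^{m′} = sitesPerDir j` — so the parameter disappears downstream.
(iii) The tree leaf is site-free: `B12Decay510Torus.treeLeafT` discharges it on the catalogue of record.

HONEST FRAMING (binding).  Count-neutral kernel bookkeeping (J27 §3 + the (5.10) polymer sum + one `Filter.Eventually`); NO estimate of Bałaban's is proved or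
asserted; nothing of the (1.7) terms of record is constructed; N22 is NOT discharged (typed 28∕28 · discharged 5∕27 UNCHANGED); K3⁷ OPEN and NOT claimed; NE9 is NOT
IN PRINT for d = 4; no count claim (the chair's single count line is the only count); one finite 𝕋⁴ programme at fixed ε — R4 closes the CONDITIONAL rung
`BalabanLadder.UV` only; NOTHING about the continuum limit, ℝ⁴, infinite volume, OS axioms, a mass gap or the Clay problem is proved or claimed by any of this.
References (TYPES only, no cite tags on the Summit side): [I] = Bałaban, CMP 109 (1987) (1.7) p. 261, (1.20)–(1.21) p. 264, p. 282, (4.35) p. 290, (5.10) p. 293;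
[II] = CMP 116 (1988) (1.26) p. 8, (1.34) p. 9; [III] = CMP 119 (1988) (2.27) p. 259.
-/

noncomputable section

open Filter Topology
open scoped BigOperators

namespace YMDAG.N22.WindowSoftTwoPoint

open Literature.MathematicalPhysics.QuantumFieldTheory.Balaban1983to89
open Literature.MathematicalPhysics.QuantumFieldTheory.Balaban1983to89.T4Continuum (T4Family)
open Literature.MathematicalPhysics.QuantumFieldTheory.Balaban1983to89.B12PolarizationTensor120 (polComp expChart)
open Literature.MathematicalPhysics.QuantumFieldTheory.Balaban1983to89.Node00 (polScalar polWindow siteOfInt)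
open Literature.MathematicalPhysics.QuantumFieldTheory.Balaban1983to89.B12Decay510
  (SiteGeometry GeomLeaf CubeSumLeaf TreeLeaf sum_abs_le delta1 delta1_nonneg delta1_le_half delta1_mul_le)
open Literature.MathematicalPhysics.QuantumFieldTheory.Balaban1983to89.B12Decay510Window (K₁)
open Literature.MathematicalPhysics.QuantumFieldTheory.Balaban1983to89.B12Decay510Torus
  (pl1 geomT geomLeafT cubeSumLeafT treeLeafT distCT nearT pl1_proj_eq_l1 proj_sub)
open Literature.MathematicalPhysics.QuantumFieldTheory.Balaban1983to89.B12TreeDecay (K₀ kappa₀ K₀_pos kappa₀_nonneg)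
open Literature.MathematicalPhysics.QuantumFieldTheory.Balaban1983to89.TreeLengthTorus (TPt TDom tsys tcubeSys torusTreeLen proj)
open Literature.MathematicalPhysics.QuantumFieldTheory.Balaban1983to89.B12Sec2to5 (l1)
open YMDAG.N22.WindowOfLocalTerms (abs_polScalar_sum_sub_le_twoPointSum abs_polScalar_sum_le_twoPointSum)

/-! ## §1 Generic site geometry: J27's §3 under PER-TERM SOFT bounds, resummed by the (5.10) polymer sum -/

section Generic
variable {𝔄 : Type*} [NormedRing 𝔄] [NormedAlgebra ℝ 𝔄] {V : Type*} [NormedAddCommGroup V] [NormedSpace ℝ V] {ι : Type*} [Fintype ι]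
  {Λ T : Type*} [Fintype Λ] [Fintype T] [DecidableEq Λ] [DecidableEq T]
  {S : LocDomainSys} {C : B12.CubeCover S} (G : SiteGeometry C T)

omit [Fintype T] [DecidableEq T] in
/-- **THE SOFT WEIGHT SUM** (the geometry of «(4.37) yields (5.10)», [I] p. 293, as packaged by `B12Decay510.sum_abs_le`): under the geometry leaf for the
distance `dist` with slope `M` and offset `c₁`, the cube-sum leaf at rate `δ₀∕2` with constant `K₁` and the domain-sum (tree) leaf at rate `κ∕2` with constant `K₀`,
for every `δ₁` with `0 ≤ δ₁ ≤ δ₀∕2`, `δ₁M ≤ κ∕2` and every pair of sites,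
`Σ_X C_E e^{−κ d_j(X)} e^{−δ₀ dist(x,X)} e^{−δ₀ dist(y,X)} ≤ C_E e^{δ₁Mc₁} K₀ K₁ e^{−δ₁ dist(x,y)}`. -/
theorem sum_softWeight_le {dist : T → T → ℝ} {CE κ δ₀ δ₁ M c₁ K0 K1 : ℝ} (hCE : 0 ≤ CE) (hK0 : 0 ≤ K0)
    (hδ₁ : 0 ≤ δ₁) (hδ₁δ₀ : δ₁ ≤ δ₀ / 2) (hδ₁κ : δ₁ * M ≤ κ / 2)
    (hgeo : GeomLeaf G dist M c₁) (hcube : CubeSumLeaf G (δ₀ / 2) K1) (htree : TreeLeaf C (κ / 2) K0) (x y : T) :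
    ∑ X : S.Dom, CE * Real.exp (-κ * S.dj X) * Real.exp (-δ₀ * G.distD x X) * Real.exp (-δ₀ * G.distD y X) ≤
      CE * Real.exp (δ₁ * M * c₁) * K0 * K1 * Real.exp (-δ₁ * dist x y) := by
  have hnn : ∀ (X : S.Dom) (x' y' : T),
      0 ≤ CE * Real.exp (-κ * S.dj X) * Real.exp (-δ₀ * G.distD x' X) * Real.exp (-δ₀ * G.distD y' X) := fun X x' y' =>
    mul_nonneg (mul_nonneg (mul_nonneg hCE (Real.exp_pos _).le) (Real.exp_pos _).le) (Real.exp_pos _).le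
  have h := sum_abs_le G (ρ := dist)
    (E2 := fun X x' y' => CE * Real.exp (-κ * S.dj X) * Real.exp (-δ₀ * G.distD x' X) * Real.exp (-δ₀ * G.distD y' X))
    hCE hK0 hδ₁ hδ₁δ₀ hδ₁κ (fun X x' y' => (abs_of_nonneg (hnn X x' y')).le) hgeo hcube htree x y
  refine le_trans (le_of_eq (Finset.sum_congr rfl fun X _ => ?_)) h
  exact (abs_of_nonneg (hnn X x y)).symm

/-- ★ **THE HISTORY DIFFERENCE OF def-B's SCALAR KERNEL OF A LOCALIZED SUM UNDER PER-TERM SOFT BOUNDS.**  Terms `ℰ X`, `ℰ' X` (the (1.7) terms at two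
coupling histories) indexed by the localization domains `X : S.Dom`, their exponential charts twice continuously differentiable at `0`; if at the pair of sites
`(x, y)` every term's colour-diagonal kernel DIFFERENCE obeys the soft bound `C_E e^{−κ d_j(X)} e^{−δ₀ dist(x,X)} e^{−δ₀ dist(y,X)}` of [I] p. 282 ∕ (4.35)
(`C_E` carrying the history modulus `Σ_i Λ_i|g_i − g′_i|`), then under the three leaves
`|Π(g)(x,y) − Π(g′)(x,y)| ≤ C_E e^{δ₁Mc₁} K₀ K₁ e^{−δ₁ dist(x,y)}` for the scalar kernel `Π = polScalar (Σ_X ℰ X)` — module J27's two-point step with `supp := univ`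
followed by the soft weight sum. -/
theorem abs_polScalar_sum_sub_le_of_softKernelBound (ℰ ℰ' : S.Dom → (Λ → T → 𝔄) → ℝ) (ρ : V →L[ℝ] 𝔄) (bV : Module.Basis ι ℝ V)
    (hℰ : ∀ X, ContDiffAt ℝ 2 (expChart (ℰ X) ρ) 0) (hℰ' : ∀ X, ContDiffAt ℝ 2 (expChart (ℰ' X) ρ) 0)
    {dist : T → T → ℝ} {CE κ δ₀ δ₁ M c₁ K0 K1 : ℝ} (hCE : 0 ≤ CE) (hK0 : 0 ≤ K0)
    (hδ₁ : 0 ≤ δ₁) (hδ₁δ₀ : δ₁ ≤ δ₀ / 2) (hδ₁κ : δ₁ * M ≤ κ / 2)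
    (hgeo : GeomLeaf G dist M c₁) (hcube : CubeSumLeaf G (δ₀ / 2) K1) (htree : TreeLeaf C (κ / 2) K0)
    (μ : Λ) (x : T) (ν : Λ) (y : T)
    (hterm : ∀ (X : S.Dom) (c : ι),
      |polComp ℝ (expChart (ℰ X) ρ) bV μ x c ν y c - polComp ℝ (expChart (ℰ' X) ρ) bV μ x c ν y c| ≤
        CE * Real.exp (-κ * S.dj X) * Real.exp (-δ₀ * G.distD x X) * Real.exp (-δ₀ * G.distD y X)) :
    |polScalar (fun U => ∑ X, ℰ X U) ρ bV μ x ν y - polScalar (fun U => ∑ X, ℰ' X U) ρ bV μ x ν y| ≤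
      CE * Real.exp (δ₁ * M * c₁) * K0 * K1 * Real.exp (-δ₁ * dist x y) := by
  classical
  have hnn : ∀ X : S.Dom, 0 ≤ CE * Real.exp (-κ * S.dj X) * Real.exp (-δ₀ * G.distD x X) * Real.exp (-δ₀ * G.distD y X) := fun X =>
    mul_nonneg (mul_nonneg (mul_nonneg hCE (Real.exp_pos _).le) (Real.exp_pos _).le) (Real.exp_pos _).le
  have h1 := abs_polScalar_sum_sub_le_twoPointSum (Finset.univ : Finset S.Dom) ℰ ℰ' ρ bV (fun X _ => hℰ X) (fun X _ => hℰ' X)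
    (fun _ => (Set.univ : Set T)) (fun X => CE * Real.exp (-κ * S.dj X) * Real.exp (-δ₀ * G.distD x X) * Real.exp (-δ₀ * G.distD y X))
    (fun X _ => hnn X) μ x ν y (fun X _ c => by
      rw [if_pos ⟨Set.mem_univ _, Set.mem_univ _⟩]
      exact hterm X c)
  rw [Finset.filter_true_of_mem fun X _ => ⟨Set.mem_univ _, Set.mem_univ _⟩] at h1
  exact h1.trans (sum_softWeight_le G hCE hK0 hδ₁ hδ₁δ₀ hδ₁κ hgeo hcube htree x y)

/-- **The VALUE twin** (the (D4)∕(5.10) input — the kernel itself): per-term soft colour-diagonal bounds `C_E e^{−κ d_j(X)} e^{−δ₀ dist(x,X)} e^{−δ₀ dist(y,X)}`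
⇒ `|Π(x,y)| ≤ C_E e^{δ₁Mc₁} K₀ K₁ e^{−δ₁ dist(x,y)}` for `Π = polScalar (Σ_X ℰ X)`. -/
theorem abs_polScalar_sum_le_of_softKernelBound (ℰ : S.Dom → (Λ → T → 𝔄) → ℝ) (ρ : V →L[ℝ] 𝔄) (bV : Module.Basis ι ℝ V)
    (hℰ : ∀ X, ContDiffAt ℝ 2 (expChart (ℰ X) ρ) 0)
    {dist : T → T → ℝ} {CE κ δ₀ δ₁ M c₁ K0 K1 : ℝ} (hCE : 0 ≤ CE) (hK0 : 0 ≤ K0)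
    (hδ₁ : 0 ≤ δ₁) (hδ₁δ₀ : δ₁ ≤ δ₀ / 2) (hδ₁κ : δ₁ * M ≤ κ / 2)
    (hgeo : GeomLeaf G dist M c₁) (hcube : CubeSumLeaf G (δ₀ / 2) K1) (htree : TreeLeaf C (κ / 2) K0)
    (μ : Λ) (x : T) (ν : Λ) (y : T)
    (hterm : ∀ (X : S.Dom) (c : ι), |polComp ℝ (expChart (ℰ X) ρ) bV μ x c ν y c| ≤
      CE * Real.exp (-κ * S.dj X) * Real.exp (-δ₀ * G.distD x X) * Real.exp (-δ₀ * G.distD y X)) :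
    |polScalar (fun U => ∑ X, ℰ X U) ρ bV μ x ν y| ≤ CE * Real.exp (δ₁ * M * c₁) * K0 * K1 * Real.exp (-δ₁ * dist x y) := by
  classical
  have hnn : ∀ X : S.Dom, 0 ≤ CE * Real.exp (-κ * S.dj X) * Real.exp (-δ₀ * G.distD x X) * Real.exp (-δ₀ * G.distD y X) := fun X =>
    mul_nonneg (mul_nonneg (mul_nonneg hCE (Real.exp_pos _).le) (Real.exp_pos _).le) (Real.exp_pos _).le
  have h1 := abs_polScalar_sum_le_twoPointSum (Finset.univ : Finset S.Dom) ℰ ρ bV (fun X _ => hℰ X)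
    (fun _ => (Set.univ : Set T)) (fun X => CE * Real.exp (-κ * S.dj X) * Real.exp (-δ₀ * G.distD x X) * Real.exp (-δ₀ * G.distD y X))
    (fun X _ => hnn X) μ x ν y (fun X _ c => by
      rw [if_pos ⟨Set.mem_univ _, Set.mem_univ _⟩]
      exact hterm X c)
  rw [Finset.filter_true_of_mem fun X _ => ⟨Set.mem_univ _, Set.mem_univ _⟩] at h1
  exact h1.trans (sum_softWeight_le G hCE hK0 hδ₁ hδ₁δ₀ hδ₁κ hgeo hcube htree x y)

end Generic
/-! ## §2 The torus of print: every geometric leaf discharged (`B12Decay510Torus`) -/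

section Torus
variable {𝔄 : Type*} [NormedRing 𝔄] [NormedAlgebra ℝ 𝔄] {V : Type*} [NormedAddCommGroup V] [NormedSpace ℝ V] {ι : Type*} [Fintype ι]
  {Λ : Type*} [Fintype Λ] [DecidableEq Λ] {d : ℕ}

/-- ★ **ON THE TORUS OF PRINT** (sites = the periodic lattice `(ℤ∕NM)^d`, cubes of side `M` indexed by `(ℤ∕N)^d`, localization domains = non-empty torus-face-connected
families of cubes `TDom d N` with `d_j = torusTreeLen`, `dist(x, X̄)` = the periodic ℓ¹ distance from the site to the nearest cube of `X̄`): per-term soft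
colour-diagonal kernel-DIFFERENCE bounds with `δ₀ > 0` and `κ ≥ 2κ₀(4·2ᵈ, 2d)` give
`|Π(g)(x,y) − Π(g′)(x,y)| ≤ C_E e^{3Mdδ₁} K₀(4·2ᵈ,2d) K₁(d,δ₀∕2) e^{−δ₁|x − y|}`, `δ₁ = ½min{δ₀, κ(Md)⁻¹}`, `|x − y|` the periodic ℓ¹ length — the geometry,
cube-sum and tree leaves being THEOREMS there (`geomLeafT`, `cubeSumLeafT`, `treeLeafT`), with the same constant table as `B12Decay510Torus.abs_twoPoint_le_torus`. -/
theorem abs_polScalar_sum_sub_le_torus (hd : 0 < d) (N M : ℕ) [NeZero N] [NeZero M]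
    (ℰ ℰ' : TDom d N → (Λ → TPt d (N * M) → 𝔄) → ℝ) (ρ : V →L[ℝ] 𝔄) (bV : Module.Basis ι ℝ V)
    (hℰ : ∀ X, ContDiffAt ℝ 2 (expChart (ℰ X) ρ) 0) (hℰ' : ∀ X, ContDiffAt ℝ 2 (expChart (ℰ' X) ρ) 0)
    {CE κ δ₀ : ℝ} (hCE : 0 ≤ CE) (hδ₀ : 0 < δ₀) (hκ : kappa₀ (4 * 2 ^ d) (2 * d) ≤ κ / 2)
    (μ : Λ) (x : TPt d (N * M)) (ν : Λ) (y : TPt d (N * M))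
    (hterm : ∀ (X : TDom d N) (c : ι),
      |polComp ℝ (expChart (ℰ X) ρ) bV μ x c ν y c - polComp ℝ (expChart (ℰ' X) ρ) bV μ x c ν y c| ≤
        CE * Real.exp (-κ * torusTreeLen X.1) * Real.exp (-δ₀ * distCT N M x (nearT (M := M) x X)) *
          Real.exp (-δ₀ * distCT N M y (nearT (M := M) y X))) :
    |polScalar (fun U => ∑ X, ℰ X U) ρ bV μ x ν y - polScalar (fun U => ∑ X, ℰ' X U) ρ bV μ x ν y| ≤
      CE * Real.exp (delta1 δ₀ κ ((M : ℝ) * d) * ((M : ℝ) * d) * 3) * K₀ (4 * 2 ^ d) (2 * d) * K₁ d (δ₀ / 2) *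
        Real.exp (-(delta1 δ₀ κ ((M : ℝ) * d)) * pl1 (x - y)) := by
  have hκ0 : 0 ≤ κ := by
    have := kappa₀_nonneg (c₀ := 4 * 2 ^ d) (by positivity) (2 * d)
    linarith
  have hMd : (0 : ℝ) < (M : ℝ) * d := mul_pos (Nat.cast_pos.2 (Nat.pos_of_neZero M)) (Nat.cast_pos.2 hd)
  exact abs_polScalar_sum_sub_le_of_softKernelBound (S := tsys d N) (geomT d N M) ℰ ℰ' ρ bV hℰ hℰ' hCE (K₀_pos _ _).le
    (delta1_nonneg hδ₀.le hκ0 hMd) (delta1_le_half δ₀ κ _) (delta1_mul_le δ₀ κ hMd) (geomLeafT d N M) (cubeSumLeafT d N M (half_pos hδ₀))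
    (treeLeafT d N hκ) μ x ν y hterm

/-- **The value twin on the torus of print**: per-term soft colour-diagonal bounds ⇒ `|Π(x,y)| ≤ C_E e^{3Mdδ₁} K₀(4·2ᵈ,2d) K₁(d,δ₀∕2) e^{−δ₁|x − y|}` (windowed,
finite-volume (5.10) shape for the kernel of a localized sum; same constants). -/
theorem abs_polScalar_sum_le_torus (hd : 0 < d) (N M : ℕ) [NeZero N] [NeZero M]
    (ℰ : TDom d N → (Λ → TPt d (N * M) → 𝔄) → ℝ) (ρ : V →L[ℝ] 𝔄) (bV : Module.Basis ι ℝ V)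
    (hℰ : ∀ X, ContDiffAt ℝ 2 (expChart (ℰ X) ρ) 0)
    {CE κ δ₀ : ℝ} (hCE : 0 ≤ CE) (hδ₀ : 0 < δ₀) (hκ : kappa₀ (4 * 2 ^ d) (2 * d) ≤ κ / 2)
    (μ : Λ) (x : TPt d (N * M)) (ν : Λ) (y : TPt d (N * M))
    (hterm : ∀ (X : TDom d N) (c : ι), |polComp ℝ (expChart (ℰ X) ρ) bV μ x c ν y c| ≤
        CE * Real.exp (-κ * torusTreeLen X.1) * Real.exp (-δ₀ * distCT N M x (nearT (M := M) x X)) *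
          Real.exp (-δ₀ * distCT N M y (nearT (M := M) y X))) :
    |polScalar (fun U => ∑ X, ℰ X U) ρ bV μ x ν y| ≤
      CE * Real.exp (delta1 δ₀ κ ((M : ℝ) * d) * ((M : ℝ) * d) * 3) * K₀ (4 * 2 ^ d) (2 * d) * K₁ d (δ₀ / 2) *
        Real.exp (-(delta1 δ₀ κ ((M : ℝ) * d)) * pl1 (x - y)) := by
  have hκ0 : 0 ≤ κ := by
    have := kappa₀_nonneg (c₀ := 4 * 2 ^ d) (by positivity) (2 * d)
    linarith
  have hMd : (0 : ℝ) < (M : ℝ) * d := mul_pos (Nat.cast_pos.2 (Nat.pos_of_neZero M)) (Nat.cast_pos.2 hd)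
  exact abs_polScalar_sum_le_of_softKernelBound (S := tsys d N) (geomT d N M) ℰ ρ bV hℰ hCE (K₀_pos _ _).le
    (delta1_nonneg hδ₀.le hκ0 hMd) (delta1_le_half δ₀ κ _) (delta1_mul_le δ₀ κ hMd) (geomLeafT d N M) (cubeSumLeafT d N M (half_pos hδ₀))
    (treeLeafT d N hκ) μ x ν y hterm

end Torus
/-! ## §3 def-B's window on the `K`-th torus: `polWindow F K j` at the sites `siteOfInt z`, `siteOfInt 0` -/

section Window
variable {𝔄 : Type*} [NormedRing 𝔄] [NormedAlgebra ℝ 𝔄] {V : Type*} [NormedAddCommGroup V] [NormedSpace ℝ V] {ι : Type*} [Fintype ι]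

/-- ★ **THE WINDOWED HISTORY-DIFFERENCE BOUND ON ONE TORUS**: for def-B's windowed kernel `polWindow F K j (Σ_X ℰ X) ρ bV μ ν z` (the scalar kernel at the sites
`z` and `0` of the unit-lattice torus `T^{(j)}` of the `K`-th approximation) and ANY site geometry `G` on `Site (F.P K) j` over the term catalogue with the three
leaves, per-term soft colour-diagonal kernel-difference bounds at the window sites give
`|Π^{(K)}(g; z) − Π^{(K)}(g′; z)| ≤ C_E e^{δ₁Mc₁} K₀ K₁ e^{−δ₁ dist(site z, site 0)}`.  (`polWindow` is `polScalar` at the window sites, `rfl`.) -/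
theorem abs_polWindow_sum_sub_le_of_softKernelBound (F : T4Family) (K j : ℕ) {S : LocDomainSys} {C : B12.CubeCover S}
    (G : SiteGeometry C (Site (F.P K) j)) (ℰ ℰ' : S.Dom → (Fin (F.P K).d → Site (F.P K) j → 𝔄) → ℝ) (ρ : V →L[ℝ] 𝔄) (bV : Module.Basis ι ℝ V)
    (hℰ : ∀ X, ContDiffAt ℝ 2 (expChart (ℰ X) ρ) 0) (hℰ' : ∀ X, ContDiffAt ℝ 2 (expChart (ℰ' X) ρ) 0)
    {dist : Site (F.P K) j → Site (F.P K) j → ℝ} {CE κ δ₀ δ₁ M c₁ K0 K1 : ℝ} (hCE : 0 ≤ CE) (hK0 : 0 ≤ K0)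
    (hδ₁ : 0 ≤ δ₁) (hδ₁δ₀ : δ₁ ≤ δ₀ / 2) (hδ₁κ : δ₁ * M ≤ κ / 2)
    (hgeo : GeomLeaf G dist M c₁) (hcube : CubeSumLeaf G (δ₀ / 2) K1) (htree : TreeLeaf C (κ / 2) K0)
    (μ ν : Fin 4) (z : Fin 4 → ℤ)
    (hterm : ∀ (X : S.Dom) (c : ι),
      |polComp ℝ (expChart (ℰ X) ρ) bV (Fin.cast (F.P_d K).symm μ) (siteOfInt F K j z) c (Fin.cast (F.P_d K).symm ν) (siteOfInt F K j 0) c -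
          polComp ℝ (expChart (ℰ' X) ρ) bV (Fin.cast (F.P_d K).symm μ) (siteOfInt F K j z) c (Fin.cast (F.P_d K).symm ν) (siteOfInt F K j 0) c| ≤
        CE * Real.exp (-κ * S.dj X) * Real.exp (-δ₀ * G.distD (siteOfInt F K j z) X) * Real.exp (-δ₀ * G.distD (siteOfInt F K j 0) X)) :
    |polWindow F K j (fun U => ∑ X, ℰ X U) ρ bV μ ν z - polWindow F K j (fun U => ∑ X, ℰ' X U) ρ bV μ ν z| ≤
      CE * Real.exp (δ₁ * M * c₁) * K0 * K1 * Real.exp (-δ₁ * dist (siteOfInt F K j z) (siteOfInt F K j 0)) :=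
  abs_polScalar_sum_sub_le_of_softKernelBound G ℰ ℰ' ρ bV hℰ hℰ' hCE hK0 hδ₁ hδ₁δ₀ hδ₁κ hgeo hcube htree _ _ _ _ hterm

/-- **The windowed VALUE bound on one torus** (the (D4)∕(5.10) input at finite volume): per-term soft colour-diagonal bounds at the window sites ⇒
`|Π^{(K)}(z)| ≤ C_E e^{δ₁Mc₁} K₀ K₁ e^{−δ₁ dist(site z, site 0)}`. -/
theorem abs_polWindow_sum_le_of_softKernelBound (F : T4Family) (K j : ℕ) {S : LocDomainSys} {C : B12.CubeCover S}
    (G : SiteGeometry C (Site (F.P K) j)) (ℰ : S.Dom → (Fin (F.P K).d → Site (F.P K) j → 𝔄) → ℝ) (ρ : V →L[ℝ] 𝔄) (bV : Module.Basis ι ℝ V)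
    (hℰ : ∀ X, ContDiffAt ℝ 2 (expChart (ℰ X) ρ) 0)
    {dist : Site (F.P K) j → Site (F.P K) j → ℝ} {CE κ δ₀ δ₁ M c₁ K0 K1 : ℝ} (hCE : 0 ≤ CE) (hK0 : 0 ≤ K0)
    (hδ₁ : 0 ≤ δ₁) (hδ₁δ₀ : δ₁ ≤ δ₀ / 2) (hδ₁κ : δ₁ * M ≤ κ / 2)
    (hgeo : GeomLeaf G dist M c₁) (hcube : CubeSumLeaf G (δ₀ / 2) K1) (htree : TreeLeaf C (κ / 2) K0)
    (μ ν : Fin 4) (z : Fin 4 → ℤ)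
    (hterm : ∀ (X : S.Dom) (c : ι),
      |polComp ℝ (expChart (ℰ X) ρ) bV (Fin.cast (F.P_d K).symm μ) (siteOfInt F K j z) c (Fin.cast (F.P_d K).symm ν) (siteOfInt F K j 0) c| ≤
        CE * Real.exp (-κ * S.dj X) * Real.exp (-δ₀ * G.distD (siteOfInt F K j z) X) * Real.exp (-δ₀ * G.distD (siteOfInt F K j 0) X)) :
    |polWindow F K j (fun U => ∑ X, ℰ X U) ρ bV μ ν z| ≤
      CE * Real.exp (δ₁ * M * c₁) * K0 * K1 * Real.exp (-δ₁ * dist (siteOfInt F K j z) (siteOfInt F K j 0)) :=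
  abs_polScalar_sum_le_of_softKernelBound G ℰ ρ bV hℰ hCE hK0 hδ₁ hδ₁δ₀ hδ₁κ hgeo hcube htree _ _ _ _ hterm

end Window
/-! ## §4 The eventual isometry of def-B's window ([I] (1.21) «T^{(j+1)} ↗ Z^d» inside one family = `K → ∞`) -/

section Isometry
variable (F : T4Family)

/-- **The level-`j` tori grow without bound along the family**: `(F.P K).sitesPerDir j = 2L^{m+K−j} → ∞` as `K → ∞` (fixed level `j`; def-B's reading (c3) of the
limit (1.21)). -/
theorem sitesPerDir_level_tendsto (j : ℕ) : Tendsto (fun K => (F.P K).sitesPerDir j) atTop atTop := by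
  have h1 : Tendsto (fun K : ℕ => K - j) atTop atTop := tendsto_sub_atTop_nat j
  have h2 : Tendsto (fun n : ℕ => F.L ^ n) atTop atTop := tendsto_pow_atTop_atTop_of_one_lt F.hL.2
  refine tendsto_atTop_mono (fun K => ?_) (h2.comp h1)
  show F.L ^ (K - j) ≤ (F.P K).sitesPerDir j
  simp only [Params.sitesPerDir, T4Family.P_L, T4Family.P_m, T4Family.P_K]
  have hL : 1 ≤ F.L := by have := F.hL.2; omega
  calc F.L ^ (K - j) ≤ F.L ^ (F.m + K - j) := Nat.pow_le_pow_right hL (by omega)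
    _ ≤ 2 * F.L ^ (F.m + K - j) := Nat.le_mul_of_pos_left _ two_pos

/-- def-B's window IS the covering projection of `TreeLengthTorus` ∕ `B12Decay510Torus` at the site modulus of `T^{(j)}` (`rfl`): `siteOfInt F K j z = proj (z ∘ cast)`. -/
theorem siteOfInt_eq_proj (K j : ℕ) (z : Fin 4 → ℤ) :
    siteOfInt F K j z = proj ((F.P K).sitesPerDir j) (fun i => z (Fin.cast (F.P_d K) i)) := rfl

/-- ★ **THE EVENTUAL ISOMETRY OF THE WINDOW**: for every separation `z ∈ ℤ⁴`, the periodic ℓ¹ distance between the window sites `siteOfInt F K j z` and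
`siteOfInt F K j 0` on the `K`-th torus `T^{(j)}` equals `|z|₁` as soon as `2L^{m+K−j} > 2|z|_∞` — for all large `K` (`B12Decay510Torus.pl1_proj_eq_l1`: small integer
vectors are their own minimal representatives). -/
theorem pl1_siteOfInt_sub_eventually (j : ℕ) (z : Fin 4 → ℤ) :
    ∀ᶠ K in atTop, pl1 (siteOfInt F K j z - siteOfInt F K j 0) = l1 z := by
  have hB : ∀ i : Fin 4, 2 * |z i| ≤ 2 * ∑ k, |z k| := fun i =>
    mul_le_mul_of_nonneg_left (Finset.single_le_sum (fun k _ => abs_nonneg (z k)) (Finset.mem_univ i)) (by norm_num)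
  filter_upwards [(sitesPerDir_level_tendsto F j).eventually_gt_atTop (2 * ∑ k, |z k|).toNat] with K hK
  have hlt : ∀ i : Fin (F.P K).d, 2 * |(fun i => z (Fin.cast (F.P_d K) i)) i| < (F.P K).sitesPerDir j := by
    intro i
    have h1 : 2 * ∑ k, |z k| < ((F.P K).sitesPerDir j : ℤ) := (Int.self_le_toNat _).trans_lt (by exact_mod_cast hK)
    exact (hB _).trans_lt h1
  have hsub : siteOfInt F K j z - siteOfInt F K j 0 = proj ((F.P K).sitesPerDir j) (fun i => z (Fin.cast (F.P_d K) i)) := by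
    funext i
    show siteOfInt F K j z i - siteOfInt F K j 0 i = _
    simp [siteOfInt, proj]
  rw [hsub, pl1_proj_eq_l1 hlt]
  rfl

end Isometry
/-! ## §5 Uniformity in the run length `K` ⇒ seat dag-n22-w3's windowed input `hK` -/

section Uniform
variable {𝔄 : Type*} [NormedRing 𝔄] [NormedAlgebra ℝ 𝔄] {V : Type*} [NormedAddCommGroup V] [NormedSpace ℝ V] {ι : Type*} [Fintype ι]
variable (F : T4Family) (j : ℕ)

/-- ★★ **K-UNIFORM SOFT BOUNDS ⇒ THE WINDOWED INPUT, EVENTUALLY IN `K`.**  A `K`-indexed family of term decompositions `ℰ K X`, `ℰ' K X` (the (1.7) terms of the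
`K`-th torus at two histories) over catalogues `S K` with cube covers `C K` and site geometries `G K` on def-B's sites `Site (F.P K) j`, with distances `dist K`;
IF the three leaves hold with constants `(M, c₁, K₁, K₀)` NOT depending on `K`, the per-term soft colour-diagonal kernel-difference bounds hold at the window sites with
`K`-free `(C_E·w, κ, δ₀)` (`w` the history modulus), and the distances dominate `|z|₁ − c₂` at the window sites for all large `K` (the isometry of §4: `c₂ = 0` for the
periodic ℓ¹ distance), THEN for all large `K`
`|Π^{(K)}(g; z) − Π^{(K)}(g′; z)| ≤ C_E e^{δ₁Mc₁} K₀ K₁ e^{δ₁c₂} · w · e^{−δ₁|z|₁}` — UNIFORM IN `K`, the shape dag-n22-w3's (1.21) passage consumes. -/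
theorem eventually_abs_polWindow_sum_sub_le (S : ℕ → LocDomainSys) (C : (K : ℕ) → B12.CubeCover (S K))
    (G : (K : ℕ) → SiteGeometry (C K) (Site (F.P K) j)) (dist : (K : ℕ) → Site (F.P K) j → Site (F.P K) j → ℝ)
    (ℰ ℰ' : (K : ℕ) → (S K).Dom → (Fin (F.P K).d → Site (F.P K) j → 𝔄) → ℝ) (ρ : V →L[ℝ] 𝔄) (bV : Module.Basis ι ℝ V)
    (hℰ : ∀ K X, ContDiffAt ℝ 2 (expChart (ℰ K X) ρ) 0) (hℰ' : ∀ K X, ContDiffAt ℝ 2 (expChart (ℰ' K X) ρ) 0)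
    {CE w κ δ₀ δ₁ M c₁ c₂ K0 K1 : ℝ} (hCE : 0 ≤ CE) (hw : 0 ≤ w) (hK0 : 0 ≤ K0)
    (hδ₁ : 0 ≤ δ₁) (hδ₁δ₀ : δ₁ ≤ δ₀ / 2) (hδ₁κ : δ₁ * M ≤ κ / 2)
    (hgeo : ∀ K, GeomLeaf (G K) (dist K) M c₁) (hcube : ∀ K, CubeSumLeaf (G K) (δ₀ / 2) K1) (htree : ∀ K, TreeLeaf (C K) (κ / 2) K0)
    (μ ν : Fin 4) (z : Fin 4 → ℤ)
    (hdist : ∀ᶠ K in atTop, l1 z - c₂ ≤ dist K (siteOfInt F K j z) (siteOfInt F K j 0))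
    (hterm : ∀ (K : ℕ) (X : (S K).Dom) (c : ι),
      |polComp ℝ (expChart (ℰ K X) ρ) bV (Fin.cast (F.P_d K).symm μ) (siteOfInt F K j z) c (Fin.cast (F.P_d K).symm ν) (siteOfInt F K j 0) c -
          polComp ℝ (expChart (ℰ' K X) ρ) bV (Fin.cast (F.P_d K).symm μ) (siteOfInt F K j z) c (Fin.cast (F.P_d K).symm ν) (siteOfInt F K j 0) c| ≤
        CE * w * Real.exp (-κ * (S K).dj X) * Real.exp (-δ₀ * (G K).distD (siteOfInt F K j z) X) *
          Real.exp (-δ₀ * (G K).distD (siteOfInt F K j 0) X)) :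
    ∀ᶠ K in atTop,
      |polWindow F K j (fun U => ∑ X, ℰ K X U) ρ bV μ ν z - polWindow F K j (fun U => ∑ X, ℰ' K X U) ρ bV μ ν z| ≤
        CE * Real.exp (δ₁ * M * c₁) * K0 * K1 * Real.exp (δ₁ * c₂) * w * Real.exp (-(δ₁ * l1 z)) := by
  filter_upwards [hdist] with K hK
  have h := abs_polWindow_sum_sub_le_of_softKernelBound F K j (G K) (ℰ K) (ℰ' K) ρ bV (hℰ K) (hℰ' K) (mul_nonneg hCE hw) hK0 hδ₁ hδ₁δ₀ hδ₁κ
    (hgeo K) (hcube K) (htree K) μ ν z (hterm K)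
  have hexp : Real.exp (-δ₁ * dist K (siteOfInt F K j z) (siteOfInt F K j 0)) ≤ Real.exp (δ₁ * c₂) * Real.exp (-(δ₁ * l1 z)) := by
    rw [← Real.exp_add]
    exact Real.exp_le_exp.2 (by nlinarith)
  have hc : 0 ≤ CE * w * Real.exp (δ₁ * M * c₁) * K0 * K1 := by
    have := (hcube K) (siteOfInt F K j 0)
    have hK1 : 0 ≤ K1 := le_trans (Finset.sum_nonneg fun c _ => (Real.exp_pos _).le) this
    exact mul_nonneg (mul_nonneg (mul_nonneg (mul_nonneg hCE hw) (Real.exp_pos _).le) hK0) hK1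
  calc |polWindow F K j (fun U => ∑ X, ℰ K X U) ρ bV μ ν z - polWindow F K j (fun U => ∑ X, ℰ' K X U) ρ bV μ ν z|
      ≤ CE * w * Real.exp (δ₁ * M * c₁) * K0 * K1 * Real.exp (-δ₁ * dist K (siteOfInt F K j z) (siteOfInt F K j 0)) := h
    _ ≤ CE * w * Real.exp (δ₁ * M * c₁) * K0 * K1 * (Real.exp (δ₁ * c₂) * Real.exp (-(δ₁ * l1 z))) := mul_le_mul_of_nonneg_left hexp hc
    _ = CE * Real.exp (δ₁ * M * c₁) * K0 * K1 * Real.exp (δ₁ * c₂) * w * Real.exp (-(δ₁ * l1 z)) := by ring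

/-- **The periodic-ℓ¹ case** (`dist K x y := |x − y|_{per,1}` on the `K`-th torus, offset `c₂ = 0` by §4's isometry): K-uniform soft bounds and leaves ⇒ for all
large `K`, `|Π^{(K)}(g; z) − Π^{(K)}(g′; z)| ≤ C_E e^{δ₁Mc₁} K₀ K₁ · w · e^{−δ₁|z|₁}`. -/
theorem eventually_abs_polWindow_sum_sub_le_pl1 (S : ℕ → LocDomainSys) (C : (K : ℕ) → B12.CubeCover (S K))
    (G : (K : ℕ) → SiteGeometry (C K) (Site (F.P K) j))
    (ℰ ℰ' : (K : ℕ) → (S K).Dom → (Fin (F.P K).d → Site (F.P K) j → 𝔄) → ℝ) (ρ : V →L[ℝ] 𝔄) (bV : Module.Basis ι ℝ V)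
    (hℰ : ∀ K X, ContDiffAt ℝ 2 (expChart (ℰ K X) ρ) 0) (hℰ' : ∀ K X, ContDiffAt ℝ 2 (expChart (ℰ' K X) ρ) 0)
    {CE w κ δ₀ δ₁ M c₁ K0 K1 : ℝ} (hCE : 0 ≤ CE) (hw : 0 ≤ w) (hK0 : 0 ≤ K0)
    (hδ₁ : 0 ≤ δ₁) (hδ₁δ₀ : δ₁ ≤ δ₀ / 2) (hδ₁κ : δ₁ * M ≤ κ / 2)
    (hgeo : ∀ K, GeomLeaf (G K) (fun x y => pl1 (x - y)) M c₁) (hcube : ∀ K, CubeSumLeaf (G K) (δ₀ / 2) K1)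
    (htree : ∀ K, TreeLeaf (C K) (κ / 2) K0) (μ ν : Fin 4) (z : Fin 4 → ℤ)
    (hterm : ∀ (K : ℕ) (X : (S K).Dom) (c : ι),
      |polComp ℝ (expChart (ℰ K X) ρ) bV (Fin.cast (F.P_d K).symm μ) (siteOfInt F K j z) c (Fin.cast (F.P_d K).symm ν) (siteOfInt F K j 0) c -
          polComp ℝ (expChart (ℰ' K X) ρ) bV (Fin.cast (F.P_d K).symm μ) (siteOfInt F K j z) c (Fin.cast (F.P_d K).symm ν) (siteOfInt F K j 0) c| ≤
        CE * w * Real.exp (-κ * (S K).dj X) * Real.exp (-δ₀ * (G K).distD (siteOfInt F K j z) X) *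
          Real.exp (-δ₀ * (G K).distD (siteOfInt F K j 0) X)) :
    ∀ᶠ K in atTop,
      |polWindow F K j (fun U => ∑ X, ℰ K X U) ρ bV μ ν z - polWindow F K j (fun U => ∑ X, ℰ' K X U) ρ bV μ ν z| ≤
        CE * Real.exp (δ₁ * M * c₁) * K0 * K1 * w * Real.exp (-(δ₁ * l1 z)) := by
  have hdist : ∀ᶠ K in atTop, l1 z - 0 ≤ (fun x y => pl1 (x - y)) (siteOfInt F K j z) (siteOfInt F K j 0) := by
    filter_upwards [pl1_siteOfInt_sub_eventually F j z] with K hK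
    rw [sub_zero]
    exact hK.symm.le
  have h := eventually_abs_polWindow_sum_sub_le F j S C G (fun K x y => pl1 (x - y)) ℰ ℰ' ρ bV hℰ hℰ' hCE hw hK0 hδ₁ hδ₁δ₀ hδ₁κ hgeo hcube htree
    μ ν z hdist hterm
  simpa only [mul_zero, Real.exp_zero, mul_one] using h

/-- Bookkeeping: a constant times the history modulus `Σ_{i<k+1} Λ_{k+1,i}|g_i − g′_i|` is the history modulus for the moduli `C·Λ`. -/
theorem const_mul_historyModulus (Cst : ℝ) (Λm : ℕ → ℕ → ℝ) (g g' : ℕ → ℝ) (k : ℕ) (e : ℝ) :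
    Cst * (∑ i ∈ Finset.range (k + 1), Λm (k + 1) i * |g i - g' i|) * e = e * ∑ i ∈ Finset.range (k + 1), Cst * Λm (k + 1) i * |g i - g' i| := by
  rw [Finset.mul_sum]
  simp only [mul_assoc]
  ring

/-- ★★ **dag-n22-w3's `hK`, LITERALLY** (the hypothesis of `YMDAG.N22.AtKernels.ne9_EA_of_windowed` at one pair of histories `g, g′`, one level `k` (window level
`j = k + 1` of def-B) and one kernel entry, with moduli `C·Λ`): K-uniform per-term soft bounds whose history modulus is `w := Σ_{i<k+1} Λ_{k+1,i}|g_i − g′_i|`, K-uniform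
leaves in the periodic ℓ¹ distance ⇒
`∀ᶠ K, |Π^{(K)}(g; z) − Π^{(K)}(g′; z)| ≤ e^{−δ₁|z|₁} · Σ_{i<k+1} (C_E e^{δ₁Mc₁} K₀ K₁ · Λ_{k+1,i}) |g_i − g′_i|`. -/
theorem eventually_abs_polWindow_sum_sub_le_hK (S : ℕ → LocDomainSys) (C : (K : ℕ) → B12.CubeCover (S K))
    (G : (K : ℕ) → SiteGeometry (C K) (Site (F.P K) j))
    (ℰ ℰ' : (K : ℕ) → (S K).Dom → (Fin (F.P K).d → Site (F.P K) j → 𝔄) → ℝ) (ρ : V →L[ℝ] 𝔄) (bV : Module.Basis ι ℝ V)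
    (hℰ : ∀ K X, ContDiffAt ℝ 2 (expChart (ℰ K X) ρ) 0) (hℰ' : ∀ K X, ContDiffAt ℝ 2 (expChart (ℰ' K X) ρ) 0)
    {CE κ δ₀ δ₁ M c₁ K0 K1 : ℝ} (Λm : ℕ → ℕ → ℝ) (g g' : ℕ → ℝ) (k : ℕ) (hΛ : ∀ i, 0 ≤ Λm (k + 1) i)
    (hCE : 0 ≤ CE) (hK0 : 0 ≤ K0) (hδ₁ : 0 ≤ δ₁) (hδ₁δ₀ : δ₁ ≤ δ₀ / 2) (hδ₁κ : δ₁ * M ≤ κ / 2)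
    (hgeo : ∀ K, GeomLeaf (G K) (fun x y => pl1 (x - y)) M c₁) (hcube : ∀ K, CubeSumLeaf (G K) (δ₀ / 2) K1)
    (htree : ∀ K, TreeLeaf (C K) (κ / 2) K0) (μ ν : Fin 4) (z : Fin 4 → ℤ)
    (hterm : ∀ (K : ℕ) (X : (S K).Dom) (c : ι),
      |polComp ℝ (expChart (ℰ K X) ρ) bV (Fin.cast (F.P_d K).symm μ) (siteOfInt F K j z) c (Fin.cast (F.P_d K).symm ν) (siteOfInt F K j 0) c -
          polComp ℝ (expChart (ℰ' K X) ρ) bV (Fin.cast (F.P_d K).symm μ) (siteOfInt F K j z) c (Fin.cast (F.P_d K).symm ν) (siteOfInt F K j 0) c| ≤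
        CE * (∑ i ∈ Finset.range (k + 1), Λm (k + 1) i * |g i - g' i|) * Real.exp (-κ * (S K).dj X) *
          Real.exp (-δ₀ * (G K).distD (siteOfInt F K j z) X) * Real.exp (-δ₀ * (G K).distD (siteOfInt F K j 0) X)) :
    ∀ᶠ K in atTop,
      |polWindow F K j (fun U => ∑ X, ℰ K X U) ρ bV μ ν z - polWindow F K j (fun U => ∑ X, ℰ' K X U) ρ bV μ ν z| ≤
        Real.exp (-(δ₁ * l1 z)) *
          ∑ i ∈ Finset.range (k + 1), (CE * Real.exp (δ₁ * M * c₁) * K0 * K1 * Λm (k + 1) i) * |g i - g' i| := by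
  have hw : 0 ≤ ∑ i ∈ Finset.range (k + 1), Λm (k + 1) i * |g i - g' i| :=
    Finset.sum_nonneg fun i _ => mul_nonneg (hΛ i) (abs_nonneg _)
  have h := eventually_abs_polWindow_sum_sub_le_pl1 F j S C G ℰ ℰ' ρ bV hℰ hℰ' hCE hw hK0 hδ₁ hδ₁δ₀ hδ₁κ hgeo hcube htree μ ν z hterm
  filter_upwards [h] with K hK
  rw [← const_mul_historyModulus]
  exact hK

end Uniform

end YMDAG.N22.WindowSoftTwoPoint

end
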